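import Summits.RiemannHypothesis.RiemannHypothesis.Theses.UniversalFactor
import Summits.RiemannHypothesis.RiemannHypothesis.Theorems.UniversalFactorLaguerreCriterion
import Summits.RiemannHypothesis.RiemannHypothesis.Theorems.LaplaceLoophole.Negative.LaplaceLoopholeResidueSeries
import Summits.RiemannHypothesis.RiemannHypothesis.Theorems.LaplaceLoophole.Negative.LaplaceLoopholeThetaCells
import Summits.RiemannHypothesis.RiemannHypothesis.Theorems.LaplaceLoophole.Negative.LaplaceLoopholeWideOsa

/-!
# RiemannHypothesis / UniversalFactor — the wide window of `LaplaceLoophole` closed: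
`F_a` has a non-real zero for EVERY `0 < a < π/8` (negative-side support for crux `LaplaceLoophole`,
item stmt-RiemannHypothesis-2575; body of `ExceptionalWideNoGo`, stmt-RiemannHypothesis-2583)

Refuter file (compute-scan seat `lscan-RiemannHypothesis-2575`).  With `F_a = deBruijnHDiv (1 + u²/a²)`:

* `UniversalFactor.PhiICert.deBruijnPhiC_I_mul` — the certificate's theta series IS the continued kernel:
  `Φ_ℂ(ia) = Σ_{m≥1} s_m(a)`; hence (`coshIntegral_eq_deBruijnPhiC`, p85398) the residue of the wide window is
  `∫₀^∞ H_0(x)cosh(ax)dx = (π/2) Σ s_m(a)` and a certified sign of `Re Σ s_m(a)` makes it non-zero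
  (`UniversalFactor.coshIntegral_ne_zero_of_re_tsum_ne_zero`), so the PROVED crux `WideKernelNoGo` applies
  (`UniversalFactor.not_hasOnlyRealZeros_laplace_of_re_tsum_ne_zero`);
* `UniversalFactor.not_hasOnlyRealZeros_laplace_of_lt_pi_div_eight` — **the wide window**: for
  `0 < a < π/8`, `¬ HasOnlyRealZeros F_a`.  Cover: `a ≤ 0.3188` — residue `> 0` by the 18 kernel-checked theta
  cells `PhiICert.re_tsum_pos_wide` (`LaplaceLoopholeThetaCells.lean`); `0.300 ≤ a ≤ 0.326` (∋ the residue zero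
  `a₀ = 0.3194150268…`, where `WideKernelNoGo` is silent) — dip certificate at `x = 41.9`
  (`UniversalFactor.osaWindowD`); `0.324 ≤ a ≤ 0.392698` — hump certificate at `x = 64.6`
  (`UniversalFactor.osaWindowH`, `LaplaceLoopholeWideOsa.lean`); `0.392698 ≤ a < π/8 (< 0.3927)` — window A of
  the medium crux (`UniversalFactor.stub_lowWindowA`); the one-point certificates conclude through the Laguerre
  inequality (`UniversalFactor.not_hasOnlyRealZeros_of_dip_certificate` / `_of_hump_certificate`);
* `UniversalFactor.not_hasOnlyRealZeros_laplace_of_integral_cosh_eq_zero` — in particular the body of the route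
  item `ExceptionalWideNoGo` (its residue hypothesis is not even needed).

With `narrowKernelNoGo` (`a ≥ 32`) and `MediumKernelNoGo_proof` (`π/8 ≤ a ≤ 32`) this completes
generalised Newman on the whole Laplace ray; the refutation `¬ LaplaceLoophole` is
`Theorems/UniversalFactorLaplaceLoopholeRefutation.lean`.
-/

noncomputable section

set_option linter.dupNamespace false

namespace Summit.RiemannHypothesis.RiemannHypothesis.Theorems

open MeasureTheory Set Filter Complex
open scoped Topology
open Literature.NumberTheory.LFunctions
open Summit.RiemannHypothesis.RiemannHypothesis.Theses

/-! ## The residue of the wide window from the theta certificate -/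

/-- The certificate's term `s_{n+1}(a)` is the `n`-th summand of `Φ_ℂ` at `u = ia`. [folklore] -/
theorem UniversalFactor.PhiICert.term_succ_eq (n : ℕ) (a : ℝ) :
    UniversalFactor.PhiICert.term (n + 1) a = UniversalFactor.deBruijnPhiSummandC n (I * a) := by
  simp only [UniversalFactor.PhiICert.term, UniversalFactor.deBruijnPhiSummandC, Nat.cast_succ]

/-- `Φ_ℂ(ia) = Σ_{m≥1} s_m(a)`. [folklore] -/
theorem UniversalFactor.PhiICert.deBruijnPhiC_I_mul (a : ℝ) :
    UniversalFactor.deBruijnPhiC (I * a) = ∑' n : ℕ, UniversalFactor.PhiICert.term (n + 1) a := by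
  unfold UniversalFactor.deBruijnPhiC
  exact tsum_congr fun n => (UniversalFactor.PhiICert.term_succ_eq n a).symm

/-- **The wide-window residue from the sign of the theta series**: for `|a| < π/8`, if
`Re Σ_{m≥1} s_m(a) ≠ 0` then `∫₀^∞ H_0(x) cosh(ax) dx ≠ 0`. [folklore] -/
theorem UniversalFactor.coshIntegral_ne_zero_of_re_tsum_ne_zero {a : ℝ} (ha : |a| < Real.pi / 8)
    (h : (∑' n : ℕ, UniversalFactor.PhiICert.term (n + 1) a).re ≠ 0) :
    (∫ x in Ioi (0:ℝ), deBruijnH 0 (x : ℂ) * (Real.cosh (a * x) : ℂ)) ≠ 0 := by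
  rw [UniversalFactor.coshIntegral_eq_deBruijnPhiC ha, UniversalFactor.PhiICert.deBruijnPhiC_I_mul]
  refine mul_ne_zero ?_ ?_
  · exact_mod_cast (by positivity : Real.pi / 2 ≠ 0)
  · intro h0
    exact h (by rw [h0]; simp)

/-- **Generalised Newman in a wide direction with certified residue sign**: `0 < a < π/8` and
`Re Σ s_m(a) ≠ 0` give a non-real zero of `F_a` (`WideKernelNoGo`, PROVED in tree). [folklore] -/
theorem UniversalFactor.not_hasOnlyRealZeros_laplace_of_re_tsum_ne_zero {a : ℝ} (ha : 0 < a)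
    (ha' : a < Real.pi / 8) (h : (∑' n : ℕ, UniversalFactor.PhiICert.term (n + 1) a).re ≠ 0) :
    ¬ HasOnlyRealZeros (deBruijnHDiv fun u : ℝ => 1 + u ^ 2 / a ^ 2) :=
  UniversalFactor.WideKernelNoGo_holds a ha ha'
    (UniversalFactor.coshIntegral_ne_zero_of_re_tsum_ne_zero (abs_lt.2 ⟨by linarith, ha'⟩) h)

/-! ## One-point Laguerre certificates → non-real zero -/

/-- A filled dip or a filled hump of the one-sided Laplace(`a`) averages of `H_0` at some `x ≥ 0` gives a
non-real zero of `F_a` (`a > 0`). [folklore] -/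
theorem UniversalFactor.not_hasOnlyRealZeros_laplace_of_dipOrHump {a : ℝ} (ha : 0 < a)
    (h : ∃ x : ℝ, 0 ≤ x ∧
      (((deBruijnH 0 x).re < 0 ∧
          0 < (∫ y in Ioi (0:ℝ), deBruijnH 0 ((x : ℂ) - y) * (Real.exp (-(a * y)) : ℂ)).re ∧
          0 < (∫ y in Ioi (0:ℝ), deBruijnH 0 ((x : ℂ) + y) * (Real.exp (-(a * y)) : ℂ)).re) ∨
        (0 < (deBruijnH 0 x).re ∧
          (∫ y in Ioi (0:ℝ), deBruijnH 0 ((x : ℂ) - y) * (Real.exp (-(a * y)) : ℂ)).re < 0 ∧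
          (∫ y in Ioi (0:ℝ), deBruijnH 0 ((x : ℂ) + y) * (Real.exp (-(a * y)) : ℂ)).re < 0))) :
    ¬ HasOnlyRealZeros (deBruijnHDiv fun u : ℝ => 1 + u ^ 2 / a ^ 2) := by
  obtain ⟨x, hx0, hcert⟩ := h
  rcases hcert with ⟨hH, hP, hQ⟩ | ⟨hH, hP, hQ⟩
  · exact UniversalFactor.not_hasOnlyRealZeros_of_dip_certificate ha hx0 hH hP hQ
  · exact UniversalFactor.not_hasOnlyRealZeros_of_hump_certificate ha hx0 hH hP hQ

/-! ## The wide window -/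

/-- **The wide window of the Laplace ray is closed: for every `0 < a < π/8` the Laplace(`a`)-smoothed
transform `F_a = deBruijnHDiv (1 + u²/a²)` has a non-real zero.**  Cover of `(0, π/8)`:
`a ≤ 0.3188` — the residue `∫₀^∞ H_0 cosh(a·) = (π/2)Φ_ℂ(ia)` is positive (theta cells) and `WideKernelNoGo`
applies; `0.3188 ≤ a ≤ 0.326` — dip certificate at `x = 41.9` (window D, through the residue zero
`a₀ = 0.31941502680…`); `0.326 ≤ a ≤ 0.392698` — hump certificate at `x = 64.6` (window H);
`0.392698 ≤ a < π/8` — window A of `MediumKernelNoGo` (`π/8 < 0.445757`). [folklore] -/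
theorem UniversalFactor.not_hasOnlyRealZeros_laplace_of_lt_pi_div_eight {a : ℝ} (ha : 0 < a)
    (ha' : a < Real.pi / 8) : ¬ HasOnlyRealZeros (deBruijnHDiv fun u : ℝ => 1 + u ^ 2 / a ^ 2) := by
  by_cases h1 : a ≤ 3188 / 10000
  · exact UniversalFactor.not_hasOnlyRealZeros_laplace_of_re_tsum_ne_zero ha ha'
      (UniversalFactor.PhiICert.re_tsum_pos_wide ha.le h1).ne'
  by_cases h2 : a ≤ (326000 : ℝ) / 1000000
  · exact UniversalFactor.not_hasOnlyRealZeros_laplace_of_dipOrHump ha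
      (UniversalFactor.osaWindowD a (by linarith) h2)
  by_cases h3 : a ≤ (392698 : ℝ) / 1000000
  · exact UniversalFactor.not_hasOnlyRealZeros_laplace_of_dipOrHump ha
      (UniversalFactor.osaWindowH a (by linarith) h3)
  · have hπ : Real.pi / 8 < (445757 : ℝ) / 1000000 := by
      have := Real.pi_lt_d2
      linarith
    exact UniversalFactor.not_hasOnlyRealZeros_laplace_of_dipOrHump ha
      (UniversalFactor.stub_lowWindowA a (by linarith) (by linarith))

/-- The same in the route's inline form (the cosine transform of `Φ(u)/(1 + u²/a²)`,
`deBruijnHDiv_laplace_eq` is `rfl`). [folklore] -/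
theorem UniversalFactor.not_hasOnlyRealZeros_laplace_of_lt_pi_div_eight' {a : ℝ} (ha : 0 < a)
    (ha' : a < Real.pi / 8) :
    ¬ HasOnlyRealZeros (fun z : ℂ => ∫ u in Set.Ioi (0:ℝ),
      ((deBruijnPhi u / (1 + u ^ 2 / a ^ 2) : ℝ) : ℂ) * Complex.cos (z * u)) :=
  UniversalFactor.not_hasOnlyRealZeros_laplace_of_lt_pi_div_eight ha ha'

/-- **The exceptional wide directions** (body of the route item `ExceptionalWideNoGo`,
stmt-RiemannHypothesis-2583): for `0 < a < π/8` with vanishing residue `∫₀^∞ H_0 cosh(a·) = 0` the transform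
`F_a` still has a non-real zero — indeed for every such `a`, residue or not. [folklore] -/
theorem UniversalFactor.not_hasOnlyRealZeros_laplace_of_integral_cosh_eq_zero {a : ℝ} (ha : 0 < a)
    (ha' : a < Real.pi / 8)
    (_h0 : (∫ x in Set.Ioi (0:ℝ), deBruijnH 0 (x : ℂ) * (Real.cosh (a * x) : ℂ)) = 0) :
    ¬ HasOnlyRealZeros (fun z : ℂ => ∫ u in Set.Ioi (0:ℝ),
      ((deBruijnPhi u / (1 + u ^ 2 / a ^ 2) : ℝ) : ℂ) * Complex.cos (z * u)) :=
  UniversalFactor.not_hasOnlyRealZeros_laplace_of_lt_pi_div_eight ha ha'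

end Summit.RiemannHypothesis.RiemannHypothesis.Theorems
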